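import Literature.NumberTheory.GaloisCohomology.PoitouTateFiniteShaDualityHolds
import HarnessLib

/-!
# Tate lifts with finite image over a general number field

For a number field `K`, a prime `ℓ` and `d`, every continuous projective representation
`r : Γ_K → PGL_d(ℚ̄_ℓ)` **with finite image** lifts to a continuous `ρ₂ : Γ_K → GL_d(ℚ̄_ℓ)` with
finite image.  Proof: Tate's theorem `H²(Γ_K, ℚ/ℤ) = 0` (unconditional in this tree for every number
field, `tate_twoCocycle_addCircle_split`) gives, through Patrikis' Remark 1.0.19 (2)
(`Patrikis2019_exists_lift_det_pow_eq_one_of_H2_addCircle`), a lift `W` with `(det W)^N = 1`; the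
image of `W` then lies in the finite set of `g ∈ GL_d` with `[g] ∈ r(Γ_K)` and `(det g)^N = 1`
(each fibre over a class `[g₀]` is `g₀ · μ_{dN}`).

This is the "Tate lift of the finite projective factor" used in the Clifford–Tate structure theorem
(`Summit.Langlands.Langlands.Theses.MonodromyDichotomy.CliffordTateStructure`, second branch).
[cite: Patrikis2019, §2.1 Remark 1.0.19 (2)] [cite: SerreDurham1977, §6.1 Thm. 4 (Tate)]
-/

set_option autoImplicit false
set_option linter.dupNamespace false

namespace Summit.Langlands.Langlands.Theorems

open Literature.NumberTheory.GaloisRepresentations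
open Literature.NumberTheory.GaloisCohomology.PoitouTateFinite
open _root_.Field _root_.Matrix _root_.Polynomial

section Fibre

variable {A : Type*} [Field A] {d : ℕ}

/-- The elements of `A` with `x ^ m = a` (`m > 0`) form a finite set. [folklore] -/
theorem setOf_pow_eq_finite {m : ℕ} (hm : 0 < m) (a : A) : {x : A | x ^ m = a}.Finite := by
  classical
  refine (Multiset.toFinset (Polynomial.nthRoots m a)).finite_toSet.subset ?_
  intro x hx
  simp only [Set.mem_setOf_eq] at hx
  simp only [Finset.mem_coe, Multiset.mem_toFinset, Polynomial.mem_nthRoots hm, hx]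

/-- The units of `A` with `u ^ m = a` (`m > 0`) form a finite set. [folklore] -/
theorem setOf_units_pow_eq_finite {m : ℕ} (hm : 0 < m) (a : A) :
    {u : Aˣ | (u : A) ^ m = a}.Finite := by
  have h : {u : Aˣ | (u : A) ^ m = a} = (Units.val : Aˣ → A) ⁻¹' {x : A | x ^ m = a} := rfl
  rw [h]
  exact (setOf_pow_eq_finite hm a).preimage Units.val_injective.injOn

/-- The fibre of `GL_d(A) → PGL_d(A)` over the class of `g₀`, cut down by `(det g)^N = 1`
(`N > 0`, `d > 0`), is finite: its elements are `g₀ · u` with `u ^ (d N) = (det g₀)^{-N}`.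
[folklore] -/
theorem setOf_mk_eq_det_pow_eq_one_finite (hd : 0 < d) {N : ℕ} (hN : 0 < N)
    (g₀ : GL (Fin d) A) :
    {g : GL (Fin d) A | (QuotientGroup.mk g : GL (Fin d) A ⧸ Subgroup.center (GL (Fin d) A)) =
        QuotientGroup.mk g₀ ∧ (g : Matrix (Fin d) (Fin d) A).det ^ N = 1}.Finite := by
  refine ((setOf_units_pow_eq_finite (Nat.mul_pos hd hN)
    (((g₀ : Matrix (Fin d) (Fin d) A).det ^ N)⁻¹)).image
    (fun u : Aˣ => g₀ * GeneralLinearGroup.scalar (Fin d) u)).subset ?_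
  rintro g ⟨hg, hdet⟩
  have hmem : g⁻¹ * g₀ ∈ Subgroup.center (GL (Fin d) A) := QuotientGroup.eq.1 hg
  rw [GeneralLinearGroup.center_eq_range_scalar] at hmem
  obtain ⟨c, hc⟩ := MonoidHom.mem_range.1 hmem
  have hgc : g = g₀ * GeneralLinearGroup.scalar (Fin d) c⁻¹ := by
    rw [map_inv, hc, _root_.mul_inv_rev, inv_inv, mul_inv_cancel_left]
  refine ⟨c⁻¹, ?_, hgc.symm⟩
  have hdet0 : (g₀ : Matrix (Fin d) (Fin d) A).det ≠ 0 := by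
    have h := (Matrix.isUnits_det_units g₀).ne_zero
    exact h
  have hval : (g : Matrix (Fin d) (Fin d) A) =
      ((c⁻¹ : Aˣ) : A) • (g₀ : Matrix (Fin d) (Fin d) A) := by
    rw [hgc, Units.val_mul, GeneralLinearGroup.coe_scalar, scalar_apply, ← smul_eq_mul_diagonal]
  rw [hval, det_smul, Fintype.card_fin, mul_pow, ← pow_mul] at hdet
  simp only [Set.mem_setOf_eq]
  exact (inv_eq_of_mul_eq_one_left hdet).symm

/-- The set of `g ∈ GL_d(A)` whose class lies in a finite set `S ⊆ PGL_d(A)` and with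
`(det g)^N = 1` is finite. [folklore] -/
theorem setOf_mk_mem_det_pow_eq_one_finite {N : ℕ} (hN : 0 < N)
    {S : Set (GL (Fin d) A ⧸ Subgroup.center (GL (Fin d) A))} (hS : S.Finite) :
    {g : GL (Fin d) A | (QuotientGroup.mk g : GL (Fin d) A ⧸ Subgroup.center (GL (Fin d) A)) ∈ S ∧
        (g : Matrix (Fin d) (Fin d) A).det ^ N = 1}.Finite := by
  rcases Nat.eq_zero_or_pos d with hd | hd
  · subst hd
    haveI : Subsingleton (Matrix (Fin 0) (Fin 0) A) := inferInstance
    haveI : Finite (GL (Fin 0) A) := Finite.of_injective _ Units.val_injective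
    exact Set.toFinite _
  · have h : {g : GL (Fin d) A | (QuotientGroup.mk g : GL (Fin d) A ⧸ Subgroup.center _) ∈ S ∧
        (g : Matrix (Fin d) (Fin d) A).det ^ N = 1} ⊆
        ⋃ q ∈ S, {g : GL (Fin d) A | (QuotientGroup.mk g : GL (Fin d) A ⧸ Subgroup.center _) =
          QuotientGroup.mk q.out ∧ (g : Matrix (Fin d) (Fin d) A).det ^ N = 1} := by
      rintro g ⟨hg, hdet⟩
      simp only [Set.mem_iUnion, Set.mem_setOf_eq]
      exact ⟨_, hg, by rw [QuotientGroup.out_eq'], hdet⟩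
    exact (hS.biUnion fun q _ => setOf_mk_eq_det_pow_eq_one_finite hd hN q.out).subset h

end Fibre

/-- **Tate lift with finite image, over a general number field.**  For a number field `K`, a prime
`ℓ` and `d`, every continuous projective representation `r : Γ_K → PGL_d(ℚ̄_ℓ)` with finite image
has a continuous lift `ρ₂ : Γ_K → GL_d(ℚ̄_ℓ)` with finite image.  (Tate: `H²(Γ_K, ℚ/ℤ) = 0`, so a
lift with finite-order determinant exists — Patrikis, Remark 1.0.19 (2); its image lies over the
finite image of `r` with `(det)^N = 1`, a finite set.)
[cite: Patrikis2019, §2.1 Remark 1.0.19 (2)] [cite: SerreDurham1977, §6.1 Thm. 4 (Tate)] -/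
theorem exists_framedGaloisRep_lift_of_finite_range (K : Type) [Field K] [NumberField K]
    (ℓ d : ℕ) [Fact ℓ.Prime]
    (r : absoluteGaloisGroup K →ₜ*
      (GL (Fin d) (PadicAlgCl ℓ) ⧸ Subgroup.center (GL (Fin d) (PadicAlgCl ℓ))))
    (hr : (Set.range r).Finite) :
    ∃ ρ₂ : FramedGaloisRep K (PadicAlgCl ℓ) d,
      (∀ σ, (QuotientGroup.mk (ρ₂ σ) : GL (Fin d) (PadicAlgCl ℓ) ⧸ Subgroup.center _) = r σ) ∧
      (Set.range fun σ : absoluteGaloisGroup K => (ρ₂ σ : GL (Fin d) (PadicAlgCl ℓ))).Finite := by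
  obtain ⟨W, N, hN, hWr, hdet⟩ := Patrikis2019_exists_lift_det_pow_eq_one_of_H2_addCircle K ℓ d
    (PoitouTateReduction.tate_twoCocycle_addCircle_split K) r
  refine ⟨W, hWr, (setOf_mk_mem_det_pow_eq_one_finite hN hr).subset ?_⟩
  rintro _ ⟨σ, rfl⟩
  exact ⟨⟨σ, (hWr σ).symm⟩, hdet σ⟩

end Summit.Langlands.Langlands.Theorems
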